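import Summits.NavierStokesRegularity.NavierStokesRegularity.Theorems.StrainDoorsSegregationRigidityFrame
import Summits.NavierStokesRegularity.NavierStokesRegularity.Theorems.StrainDoorsVirialLiquidation
import Summits.NavierStokesRegularity.NavierStokesRegularity.Theorems.StrainDoorsCompositions
import Summits.NavierStokesRegularity.NavierStokesRegularity.Theorems.StrainDoorsMagicCone
import Literature.Analysis.FluidPDE.TaoEnstrophyLocalisationProofs
import Literature.Analysis.FluidPDE.LerayLocalRegularH1Proofs
import HarnessLib

/-!
# Strain doors — EXACT VACUITY OF DOOR D11's SEGREGATION HYPOTHESIS; D11 without its parity clause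

LEAD S-door engine plate (ns-s30-p1 g5) closing the analysis of nsreg-p1's door D11 «MagicConeDoor» (ROUND-48) begun in
ROUND-49 («rigidity of favourable segregation», `StrainDoorsSegregationRigidity(NS).lean`) and its frame companions
(`StrainDoorsAnalyticFrame.lean`, `StrainDoorsSegregationRigidityFrame.lean`).  Standing frame: classical unforced
solution `(u,p)` on `[0,T)`, `ν > 0`, Sobolev-bounded on every `[0,T'']`, `T'' < T`.

THE CHAIN.  At a time `0 < t < T`, the segregation half (i) of D11's hypothesis (at every `δ`-almost strain record
charged above `l₀`) together with ONE `δ'`-almost record with level margin gives `q(t,·) = ½|ω|² − |S|² ≡ 0`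
(`qDensity_eq_zero_of_D11_hypothesis_of_frame`), i.e. `tr((∇u)²) ≡ 0`, i.e. `div((u·∇)u)(t,·) ≡ 0`
(`divergence_convect_eq_zero_of_qDensity_eq_zero`, tree `divergence_convect_self_eq` +
`frobeniusNormSq_fderiv_eq_sq_norm_curl_add_trace`); since `|u(t)|² ∈ L¹` (Sobolev `n = 0`), VIRIAL LIQUIDATION
(`eq_zero_of_divergence_convect_self_eq_zero`) forces `u(t,·) ≡ 0` — contradicting the charge.  Hence:

* `not_charged_record_of_D11_hypothesis_of_frame` ★★ — under (i) at time `t > 0` there is NO charged `δ'`-almost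
  record with margin (`δ' < δ`): D11's hypothesis is satisfiable only vacuously;
* `strainQuad_le_of_D11_hypothesis_of_frame` ★★ — under (i) at time `t > 0`, `⟪∇u(t,x)e,e⟫ ≤ l₀/(1−δ)` for EVERY
  `x` and unit `e` (a supremum/almost-maximiser argument): the sign hypothesis forces the strain below its own
  charging level;
* `hasSobolevExtensionPast_of_segregation` ★★ — DOOR D11 WITHOUT ITS PARITY CLAUSE (ii): (i) on `[t₀,T)` ⇒ the
  solution extends past `T` (strain bounded ⇒ door Λ `subcriticalStrainDoor_holds`, `y₀ = ½`);
  `magicConeDoor_of_segregation_alone` — a second proof of `MagicConeDoor` reading clause (i) only.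

HONEST FRAME: the EXACT-VACUITY verdict on a door HYPOTHESIS (strengthens ROUND-49's near-vacuity: the only sign-type
strengthening of fixed-scale parity is not merely rigid but empty at charged positive times); crux movement 0;
item 0056 `NoTypeII` / 10661 / NS regularity are NOT proved; no blow-up is excluded.
`--supports stmt-NavierStokesRegularity-0056 --as helper`.
-/

noncomputable section

open MeasureTheory Set Function Filter InnerProductSpace Metric
open scoped RealInnerProductSpace ContDiff Topology Laplacian ENNReal NNReal
open Real Literature.Analysis Literature.Analysis.FluidPDE Literature.Analysis.FluidPDE.VorticityDirectionDynamics

set_option linter.dupNamespace false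

namespace Summit.NavierStokesRegularity.NavierStokesRegularity.Theorems.StrainDoors


/-! ## The Navier–Stokes consequences: D11's segregation hypothesis is VACUOUS at charged positive times -/

/-- support (frame): `|u(t)|² ∈ L¹` at every `t ∈ [0,T)` (Sobolev bound `n = 0`). -/
theorem integrable_norm_sq_of_frame {ν T : ℝ}
    {u : ℝ → (EuclideanSpace ℝ (Fin 3)) → (EuclideanSpace ℝ (Fin 3))} {p : ℝ → (EuclideanSpace ℝ (Fin 3)) → ℝ}
    (hsol : IsClassicalNSSolutionOn (Ico 0 T) ν 0 u p) (hSob : ∀ T'' < T, HasBoundedSobolevNormsOn (Icc 0 T'') u)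
    {t : ℝ} (ht : t ∈ Ico 0 T) : Integrable (fun x => ‖u t x‖ ^ 2) := by
  have hc : Continuous (u t) := (hsol.contDiff_velocity ht).continuous
  obtain ⟨C, hC⟩ := hSob t ht.2 0
  have h0 : ∫⁻ x, ‖u t x‖ₑ ^ 2 < ⊤ := by
    refine lt_of_le_of_lt (le_of_eq (lintegral_congr fun x => ?_)) ((hC t ⟨ht.1, le_rfl⟩).trans_lt ENNReal.coe_lt_top)
    rw [← ofReal_norm, ← norm_iteratedFDeriv_zero (𝕜 := ℝ) (f := u t), ofReal_norm]
  have hmem : MemLp (u t) 2 volume := by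
    refine ⟨hc.aestronglyMeasurable, ?_⟩
    rw [eLpNorm_lt_top_iff_lintegral_rpow_enorm_lt_top two_ne_zero ENNReal.ofNat_ne_top]
    simpa using h0
  exact (memLp_two_iff_integrable_sq_norm hc.aestronglyMeasurable).1 hmem

/-- support (frame): if the Q-field vanishes identically at a time `t ∈ [0,T)`, `q(t,·) ≡ 0`, then the convective
derivative is divergence free there: `div((u·∇)u)(t,·) ≡ 0` (`div((u·∇)u) = tr((∇u)²) = |∇u|²_F − |ω|² = −q`). -/
theorem divergence_convect_eq_zero_of_qDensity_eq_zero {ν T : ℝ}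
    {u : ℝ → (EuclideanSpace ℝ (Fin 3)) → (EuclideanSpace ℝ (Fin 3))} {p : ℝ → (EuclideanSpace ℝ (Fin 3)) → ℝ}
    (hsol : IsClassicalNSSolutionOn (Ico 0 T) ν 0 u p) {t : ℝ} (ht : t ∈ Ico 0 T)
    (hq : ∀ x, qDensity u t x = 0) (x : (EuclideanSpace ℝ (Fin 3))) : VectorCalculus.divergence (convect (u t) (u t)) x = 0 := by
  have hu2 : ContDiff ℝ 2 (u t) := (hsol.contDiff_velocity ht).of_le (by norm_cast)
  rw [divergence_convect_self_eq hu2 (hsol.divFree t ht)]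
  have h1 := frobeniusNormSq_fderiv_eq_sq_norm_curl_add_trace (u t) x
  have h2 := qDensity_eq_norm_curl_sq_sub u t x
  rw [hq x] at h2
  linarith

/-- ★★ EXACT VACUITY OF D11's SEGREGATION HYPOTHESIS AT CHARGED POSITIVE TIMES.  In the door frame (classical unforced
solution on `[0,T)`, `ν > 0`, Sobolev-bounded on every `[0,T'']`), if at a time `0 < t < T` the segregation half of D11
holds at every `δ`-almost strain record charged above `l₀` (scales `0 < r₀ < r₁`), then there is NO `δ'`-almost record
(`δ' < δ`) with level margin `l₀ < ((1−δ)/(1−δ'))·λ` — for such a record forces `q(t,·) ≡ 0` (R49 §25, frame version),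
hence `div((u·∇)u) ≡ 0`, hence `u(t,·) ≡ 0` by virial liquidation, contradicting the charge. -/
theorem not_charged_record_of_D11_hypothesis_of_frame {ν T : ℝ} (hν : 0 < ν)
    {u : ℝ → (EuclideanSpace ℝ (Fin 3)) → (EuclideanSpace ℝ (Fin 3))} {p : ℝ → (EuclideanSpace ℝ (Fin 3)) → ℝ}
    (hsol : IsClassicalNSSolutionOn (Ico 0 T) ν 0 u p) (hSob : ∀ T'' < T, HasBoundedSobolevNormsOn (Icc 0 T'') u)
    {t : ℝ} (ht : t ∈ Ioo 0 T)
    {δ δ' l₀ r₀ r₁ : ℝ} (hl₀ : 0 < l₀) (hδ'δ : δ' < δ) (hδ1 : δ < 1) (hr₀ : 0 < r₀) (hr₁ : r₀ < r₁)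
    (hD11 : ∀ x e, IsStrainAlmostArgmax δ u t x e → l₀ < strainQuad u t x e →
      ∀ y, 0 ≤ newtonNearHess r₀ r₁ e e (x - y) * (qDensity u t y - qDensity u t x))
    {x₀ e₀ : (EuclideanSpace ℝ (Fin 3))} (hx₀ : IsStrainAlmostArgmax δ' u t x₀ e₀)
    (hl : l₀ < (1 - δ) / (1 - δ') * strainQuad u t x₀ e₀) : False := by
  have ht' : t ∈ Ico 0 T := ⟨ht.1.le, ht.2⟩
  have hq := (qDensity_eq_zero_of_D11_hypothesis_of_frame hν hsol hSob ht hl₀ hδ'δ hδ1 hr₀ hr₁ hD11 hx₀ hl).1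
  have hw := divergence_convect_eq_zero_of_qDensity_eq_zero hsol ht' hq
  have hu2 : ContDiff ℝ 2 (u t) := (hsol.contDiff_velocity ht').of_le (by norm_cast)
  have hzero : u t = 0 :=
    eq_zero_of_divergence_convect_self_eq_zero hu2 (hsol.divFree t ht') (integrable_norm_sq_of_frame hsol hSob ht') hw
  -- the record is charged: `strainQuad u t x₀ e₀ > 0`, but `u t = 0`
  have hκ : 0 < (1 - δ) / (1 - δ') := div_pos (by linarith) (by linarith)
  have hpos : 0 < strainQuad u t x₀ e₀ := by
    by_contra h
    push Not at h
    have : (1 - δ) / (1 - δ') * strainQuad u t x₀ e₀ ≤ 0 := mul_nonpos_of_nonneg_of_nonpos hκ.le h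
    linarith
  have hzero' : strainQuad u t x₀ e₀ = 0 := by
    unfold strainQuad
    rw [hzero]
    simp
  linarith

/-- ★★ D11's SEGREGATION HYPOTHESIS BOUNDS THE STRAIN OUTRIGHT.  In the door frame, if at a time `0 < t < T` the
segregation half of D11 holds at every `δ`-almost strain record charged above `l₀` (`0 < δ < 1`, `0 < l₀`, scales
`0 < r₀ < r₁`), then `⟪∇u(t,x)e,e⟫ ≤ l₀/(1−δ)` for EVERY point `x` and unit `e`: the hypothesis can only hold because no
charged record (with any margin) exists at all. -/
theorem strainQuad_le_of_D11_hypothesis_of_frame {ν T : ℝ} (hν : 0 < ν)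
    {u : ℝ → (EuclideanSpace ℝ (Fin 3)) → (EuclideanSpace ℝ (Fin 3))} {p : ℝ → (EuclideanSpace ℝ (Fin 3)) → ℝ}
    (hsol : IsClassicalNSSolutionOn (Ico 0 T) ν 0 u p) (hSob : ∀ T'' < T, HasBoundedSobolevNormsOn (Icc 0 T'') u)
    {t : ℝ} (ht : t ∈ Ioo 0 T)
    {δ l₀ r₀ r₁ : ℝ} (hl₀ : 0 < l₀) (hδ : 0 < δ) (hδ1 : δ < 1) (hr₀ : 0 < r₀) (hr₁ : r₀ < r₁)
    (hD11 : ∀ x e, IsStrainAlmostArgmax δ u t x e → l₀ < strainQuad u t x e →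
      ∀ y, 0 ≤ newtonNearHess r₀ r₁ e e (x - y) * (qDensity u t y - qDensity u t x))
    (x : (EuclideanSpace ℝ (Fin 3))) {e : (EuclideanSpace ℝ (Fin 3))} (he : ‖e‖ = 1) : strainQuad u t x e ≤ l₀ / (1 - δ) := by
  have ht' : t ∈ Ico 0 T := ⟨ht.1.le, ht.2⟩
  by_contra hcon
  push Not at hcon
  -- a uniform bound on the strain form at time `t` (Sobolev class, `n = 1`)
  have hsm : ∀ s ∈ Icc (0 : ℝ) t, ContDiff ℝ ∞ (u s) := fun s hs =>
    hsol.contDiff_velocity ⟨hs.1, lt_of_le_of_lt hs.2 ht.2⟩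
  obtain ⟨B, hB⟩ := exists_forall_norm_iteratedFDeriv_le_of_hasBoundedSobolevNormsOn hsm (hSob t ht.2) 1
  have hle : ∀ (y e' : (EuclideanSpace ℝ (Fin 3))), ‖e'‖ = 1 → strainQuad u t y e' ≤ B := by
    intro y e' he'
    have h1 : ‖fderiv ℝ (u t) y‖ ≤ B := by
      have := hB t ⟨ht'.1, le_rfl⟩ y
      rwa [norm_iteratedFDeriv_one] at this
    unfold strainQuad
    calc ⟪fderiv ℝ (u t) y e', e'⟫ ≤ ‖fderiv ℝ (u t) y e'‖ * ‖e'‖ := real_inner_le_norm _ _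
      _ ≤ ‖fderiv ℝ (u t) y‖ * ‖e'‖ * ‖e'‖ :=
          mul_le_mul_of_nonneg_right (ContinuousLinearMap.le_opNorm _ _) (norm_nonneg _)
      _ = ‖fderiv ℝ (u t) y‖ := by rw [he']; ring
      _ ≤ B := h1
  -- the supremum of the strain form over points and unit directions
  set V : Set ℝ := {q : ℝ | ∃ (y e' : (EuclideanSpace ℝ (Fin 3))), ‖e'‖ = 1 ∧ q = strainQuad u t y e'} with hV
  have hVbdd : BddAbove V := ⟨B, by rintro q ⟨y, e', he', rfl⟩; exact hle y e' he'⟩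
  have hxV : strainQuad u t x e ∈ V := ⟨x, e, he, rfl⟩
  set S : ℝ := sSup V with hS
  have hxS : strainQuad u t x e ≤ S := le_csSup hVbdd hxV
  have hall : ∀ (y e' : (EuclideanSpace ℝ (Fin 3))), ‖e'‖ = 1 → strainQuad u t y e' ≤ S := fun y e' he' => le_csSup hVbdd ⟨y, e', he', rfl⟩
  have h1δ : 0 < 1 - δ := by linarith
  have hS0 : l₀ / (1 - δ) < S := hcon.trans_le hxS
  have hSpos : 0 < S := lt_trans (div_pos hl₀ h1δ) hS0
  -- a `δ/2`-almost record with margin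
  set δ' : ℝ := δ / 2 with hδ'
  have hδ'δ : δ' < δ := by rw [hδ']; linarith
  have h1δ' : 0 < 1 - δ' := by rw [hδ']; linarith
  have hlt : (1 - δ') * S < S := by
    have : (1 - δ') < 1 := by rw [hδ']; linarith
    calc (1 - δ') * S < 1 * S := mul_lt_mul_of_pos_right this hSpos
      _ = S := one_mul _
  obtain ⟨q₀, ⟨x₀, e₀, he₀, rfl⟩, hq₀⟩ := exists_lt_of_lt_csSup ⟨_, hxV⟩ hlt
  have hax : IsStrainAlmostArgmax δ' u t x₀ e₀ := by
    refine ⟨he₀, fun y e' he' => ?_⟩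
    calc (1 - δ') * strainQuad u t y e' ≤ (1 - δ') * S := mul_le_mul_of_nonneg_left (hall y e' he') h1δ'.le
      _ ≤ strainQuad u t x₀ e₀ := hq₀.le
  have hmargin : l₀ < (1 - δ) / (1 - δ') * strainQuad u t x₀ e₀ := by
    have h1 : l₀ < (1 - δ) * S := by
      have := (div_lt_iff₀ h1δ).1 hS0
      linarith
    have h2 : (1 - δ) * S = (1 - δ) / (1 - δ') * ((1 - δ') * S) := by
      field_simp
    have h3 : (1 - δ) / (1 - δ') * ((1 - δ') * S) ≤ (1 - δ) / (1 - δ') * strainQuad u t x₀ e₀ :=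
      mul_le_mul_of_nonneg_left hq₀.le (div_pos h1δ h1δ').le
    linarith
  exact not_charged_record_of_D11_hypothesis_of_frame hν hsol hSob ht hl₀ hδ'δ hδ1 hr₀ hr₁ hD11 hax hmargin

/-- ★★ DOOR D11 WITHOUT ITS PARITY CLAUSE IS A THEOREM — because the sign hypothesis forces the strain below its own
charging level.  Classical unforced solution on `[0,T)`, `ν > 0`, Sobolev-bounded on every `[0,T'']`, `T'' < T`;
level `l₀ > 0`, tolerance `0 < δ < 1`, scales `0 < r₀ < r₁`.  IF on `[t₀,T)` at every `δ`-almost strain record charged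
above `l₀` the Q-excess is favourably segregated, `K_ee(x − y)(q(t,y) − q(t,x)) ≥ 0` for all `y` (clause (i) of
`MagicConeDoor`; clause (ii) is NOT assumed), THEN the solution extends past `T` in the Sobolev class
(`strainQuad ≤ l₀/(1−δ)` on `(0,T) ∩ [t₀,T)` by `strainQuad_le_of_D11_hypothesis_of_frame`, then door Λ
`subcriticalStrainDoor_holds` with `y₀ = ½`). -/
theorem hasSobolevExtensionPast_of_segregation {ν T t₀ l₀ δ r₀ r₁ : ℝ} (hν : 0 < ν) (ht₀ : 0 ≤ t₀) (ht₀T : t₀ < T)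
    (hl₀ : 0 < l₀) (hδ : 0 < δ) (hδ1 : δ < 1) (hr₀ : 0 < r₀) (hr₁ : r₀ < r₁)
    {u : ℝ → (EuclideanSpace ℝ (Fin 3)) → (EuclideanSpace ℝ (Fin 3))} {p : ℝ → (EuclideanSpace ℝ (Fin 3)) → ℝ}
    (hsol : IsClassicalNSSolutionOn (Ico 0 T) ν 0 u p) (hSob : ∀ T'' < T, HasBoundedSobolevNormsOn (Icc 0 T'') u)
    (hseg : ∀ t ∈ Ico t₀ T, ∀ (x e : (EuclideanSpace ℝ (Fin 3))), IsStrainAlmostArgmax δ u t x e → l₀ < strainQuad u t x e →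
      ∀ y, 0 ≤ newtonNearHess r₀ r₁ e e (x - y) * (qDensity u t y - qDensity u t x)) :
    HasSobolevExtensionPast ν u T := by
  set L : ℝ := l₀ / (1 - δ) with hL
  have hLpos : 0 < L := div_pos hl₀ (by linarith)
  have hT : 0 < T := lt_of_le_of_lt ht₀ ht₀T
  -- the window `[t₁, T)`, `t₁ = max (max t₀ (T/2)) (T − 1/(2L)) > 0`
  set t₁ : ℝ := max (max t₀ (T / 2)) (T - 1 / (2 * L)) with ht₁
  have ht₁0 : 0 ≤ t₁ := ht₀.trans ((le_max_left _ _).trans (le_max_left _ _))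
  have ht₁pos : 0 < t₁ := lt_of_lt_of_le (by linarith : 0 < T / 2) ((le_max_right _ _).trans (le_max_left _ _))
  have ht₁T : t₁ < T := by
    rw [ht₁]
    refine max_lt (max_lt ht₀T (by linarith)) ?_
    have := div_pos one_pos (mul_pos two_pos hLpos)
    linarith
  refine subcriticalStrainDoor_holds ν T t₁ (1 / 2) hν ht₁0 ht₁T (by norm_num) u p hsol hSob ?_
  intro t ht x e he
  have htpos : 0 < t := lt_of_lt_of_le ht₁pos ht.1
  have htt₀ : t₀ ≤ t := ((le_max_left _ _).trans (le_max_left _ _)).trans ht.1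
  have hq : strainQuad u t x e ≤ L :=
    strainQuad_le_of_D11_hypothesis_of_frame hν hsol hSob ⟨htpos, ht.2⟩ hl₀ hδ hδ1 hr₀ hr₁ (hseg t ⟨htt₀, ht.2⟩) x he
  have hTt : T - t ≤ 1 / (2 * L) := by
    have := (le_max_right (max t₀ (T / 2)) (T - 1 / (2 * L))).trans ht.1
    linarith
  have hTt0 : 0 < T - t := sub_pos.2 ht.2
  by_cases hsgn : 0 ≤ strainQuad u t x e
  · calc (T - t) * strainQuad u t x e ≤ 1 / (2 * L) * L :=
          mul_le_mul hTt hq hsgn (by positivity)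
      _ = 1 / 2 := by field_simp
  · push Not at hsgn
    have : (T - t) * strainQuad u t x e ≤ 0 := mul_nonpos_of_nonneg_of_nonpos hTt0.le hsgn.le
    linarith

/-- ★ In particular `MagicConeDoor` (D11) follows WITHOUT USING ITS PARITY CLAUSE (ii) — a second, independent proof
of `magicConeDoor_holds` that reads clause (i) alone. -/
theorem magicConeDoor_of_segregation_alone : MagicConeDoor := by
  intro ν T t₀ l₀ δ r₀ r₁ hν ht₀ hT hl₀ hδ hδ1 hr₀ hr₁ u p hsol hreg hhyp
  exact hasSobolevExtensionPast_of_segregation hν ht₀ hT hl₀ hδ hδ1 hr₀ hr₁ hsol hreg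
    fun t ht x e hax hl => (hhyp t ht x e hax hl).1

end Summit.NavierStokesRegularity.NavierStokesRegularity.Theorems.StrainDoors

end
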